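import Summits.Ventures.CertifiedManyBodySolver.Observables.EtaPairingExclusionAboveThreeHalvesFilling
import Summits.Ventures.CertifiedManyBodySolver.Observables.EtaPairingExclusionGridCellsOddU
import HarnessLib

/-!
# η-PAIRING ODLRO EXCLUSION ON THE ELECTRON-DOPED SIDE: the generic particle–hole MIRROR of a cell / window, and the
# electron-doped TWINS `(U, 2 − n, 0)` of every certified hole-doped cell and of the weak-coupling windows

HONEST FRAMING: exclusions in Yang's staggered `s`-wave (η) pair channel, where nobody expects order; NOTHING about `d`-wave
pairing or the uniform on-site channel; CTL/dictionary class; not a superconductivity verdict; no phase sentence. Crew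
hubbard-obs (D-0042), seat hubbard-obs-p1 (`prover-hubbard-obs-p1-g15-0`); part 4 of the g15 η files. ZERO compute; no
definition; no `sorry`; the ONLY claim nodes are those of the hole-doped cell theorems being mirrored, taken BY NAME through
those theorems (g13 `EtaPairingExclusionA0prime`, g14 `EtaPairingExclusionGridCells[OddU]`).

* §1 `etaPairing_exclusion_mirror` — THE GENERIC MIRROR: if every translation-invariant ground state of density `m`
  (`0 < m < 2`, `U ≥ 0`, `t' = 0`) obeys the cell conclusion «`M⁻⁴ Re ω(η†η) → 0` and `Re ω(η†_Λ η_Λ) ≤ 64(|Λ'| − |Λ|)²/c²`»,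
  then every translation-invariant ground state of density `2 − m` obeys «`M⁻⁴ Re ω(η†η) → 0` and
  `Re ω(η†_Λ η_Λ) ≤ 64(|Λ'| − |Λ|)²/c² + (1 − m)|Λ|`» — Lieb's staggered particle–hole automorphism at the state level
  (part 3: `groundStateClass_particleHole`, `re_particleHole_expect_etaRaise_mul_etaLower`; the `O(|Λ|)` term is the
  commutator `[η_Λ, η†_Λ] = |Λ| − N_Λ`, invisible at the ODLRO scale `|Λ|²`).
* §2 the ELECTRON-DOPED TWINS of the certified hole-doped cells, from the SAME claim nodes BY NAME: `(8, 9/8)` [A0′ twin: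
  #450, #505, #472], `(6, 9/8)` [#426, #473, #21], `(8, 5/4)` [#516, #472], `(8, 6/5)` [#515, #472], `(4, 5/4)` [#518, #20],
  `(4, 6/5)` [#512, #20], `(6, 5/4)` [#518, #516, #21], `(6, 6/5)` [#512, #515, #21], `(2, 6/5)` [#527, #27], `(5, 5/4)`
  [#518, #516, #396], `(5, 6/5)` [#512, #515, #396], `(3, 6/5)` [#527, #512, #395] (the registry has no electron-doped rows;
  particle–hole symmetry makes these cells free). `(8, 3/2)` needs no node: part 3 `etaPairing_exclusion_threeHalvesFilling`.
* the mirrored WEAK-COUPLING WINDOWS at `n = 13/10, 5/4, 6/5, 9/8` are in the companion file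
  `EtaPairingExclusionElectronDopedWindows` (same §1 mirror applied to the part-2 margins).

References: E. H. Lieb, PRL 62 (1989) 1201, proof of Thm 2 [LiebPRL1989]; C. N. Yang, S. C. Zhang, Mod. Phys. Lett. B 4
(1990) 759, Thm 1 [YangZhang1990]; C. N. Yang, PRL 63 (1989) 2144 [Yang1989]; O. Bratteli, D. W. Robinson, OAQSM 2 (1997)
Prop. 5.3.19 [BratteliRobinsonII1997].
-/

noncomputable section

namespace Summit.Ventures.CertifiedManyBodySolver.Observables

open Matrix Finset Filter Literature.MathematicalPhysics.QuantumLattice Literature.Probability.LatticeModels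
open Literature.MathematicalPhysics.QuantumLattice.HubbardWave0 ThermodynamicLimit
open Summit.Ventures.CertifiedManyBodySolver.Certificates
open scoped ComplexOrder Topology

/-! ### §1 The generic particle–hole mirror of a cell / window conclusion -/

/-- **THE GENERIC MIRROR.** Let `U ≥ 0`, `0 < m < 2`, `c > 0`... (`c` any real: only `c²` enters). If EVERY
translation-invariant ground state `ω'` of density `m` (`e(ω') = e(1,0,U,m)`) satisfies `M⁻⁴ Re ω'(η†_{Λ_M} η_{Λ_M}) → 0`
and `Re ω'(η†_Λ η_Λ) ≤ 64(|Λ'| − |Λ|)²/c²` (`Λ' ⊇ thicken Λ 1`), then every translation-invariant ground state `ω` of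
density `2 − m` satisfies `M⁻⁴ Re ω(η†_{Λ_M} η_{Λ_M}) → 0` and `Re ω(η†_Λ η_Λ) ≤ 64(|Λ'| − |Λ|)²/c² + (1 − m)|Λ|`
(apply the hypothesis to `ω ∘ α`, a translation-invariant ground state of density `m`, and transport back with
`Re ω(η†_Λ η_Λ) = Re (ω ∘ α)(η†_Λ η_Λ) + (1 − m)|Λ|`). [cite: LiebPRL1989, proof of Theorem 2] [cite: YangZhang1990, Theorem 1] -/
theorem etaPairing_exclusion_mirror {U m c : ℝ} (hU : 0 ≤ U) (hm0 : 0 < m) (hm2 : m < 2)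
    (h : ∀ {ω' : InfVolFermionState 2}, ω'.IsTranslationInvariant → ω'.density = m →
      ω'.meanEnergy (hubbardTTPrimeFermionInteraction 1 0 U) 1 = energyDensityTT' 1 0 U m →
      Tendsto (fun M : ℕ =>
          (ω'.expect (halfOpenBox 2 M) (etaRaise (fun w : PolySite (halfOpenBox 2 M) => siteStagger (ofLex w.1)) *
            etaLower (fun w : PolySite (halfOpenBox 2 M) => siteStagger (ofLex w.1)))).re / (M : ℝ) ^ 4)
          atTop (𝓝 0) ∧
        ∀ {Λ Λ' : Finset (Site 2)}, Λ ⊆ Λ' → thicken Λ 1 ⊆ Λ' →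
          (ω'.expect Λ (etaRaise (fun w : PolySite Λ => siteStagger (ofLex w.1)) *
              etaLower (fun w : PolySite Λ => siteStagger (ofLex w.1)))).re ≤
            64 * ((#Λ' : ℝ) - #Λ) ^ 2 / c ^ 2)
    {ω : InfVolFermionState 2} (hω : ω.IsTranslationInvariant) (hρ : ω.density = 2 - m)
    (hme : ω.meanEnergy (hubbardTTPrimeFermionInteraction 1 0 U) 1 = energyDensityTT' 1 0 U (2 - m)) :
    Tendsto (fun M : ℕ =>
        (ω.expect (halfOpenBox 2 M) (etaRaise (fun w : PolySite (halfOpenBox 2 M) => siteStagger (ofLex w.1)) *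
          etaLower (fun w : PolySite (halfOpenBox 2 M) => siteStagger (ofLex w.1)))).re / (M : ℝ) ^ 4)
        atTop (𝓝 0) ∧
      ∀ {Λ Λ' : Finset (Site 2)}, Λ ⊆ Λ' → thicken Λ 1 ⊆ Λ' →
        (ω.expect Λ (etaRaise (fun w : PolySite Λ => siteStagger (ofLex w.1)) *
            etaLower (fun w : PolySite Λ => siteStagger (ofLex w.1)))).re ≤
          64 * ((#Λ' : ℝ) - #Λ) ^ 2 / c ^ 2 + (1 - m) * #Λ := by
  obtain ⟨hω', hρ', hme'⟩ := groundStateClass_particleHole hU (n := 2 - m) (by linarith) (by linarith) hω hρ hme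
  rw [show (2 : ℝ) - (2 - m) = m by ring] at hρ' hme'
  have hA := h hω' hρ' hme'
  have hkey : ∀ Λ : Finset (Site 2),
      (ω.expect Λ (etaRaise (fun w : PolySite Λ => siteStagger (ofLex w.1)) *
          etaLower (fun w : PolySite Λ => siteStagger (ofLex w.1)))).re =
        (ω.particleHole.expect Λ (etaRaise (fun w : PolySite Λ => siteStagger (ofLex w.1)) *
          etaLower (fun w : PolySite Λ => siteStagger (ofLex w.1)))).re + (1 - m) * #Λ := fun Λ => by
    have h := re_particleHole_expect_etaRaise_mul_etaLower hω' Λ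
    rw [InfVolFermionState.particleHole_particleHole, hρ'] at h
    rw [h]
  refine ⟨?_, fun {Λ Λ'} hΛ h8 => ?_⟩
  · have hsplit : (fun M : ℕ =>
        (ω.expect (halfOpenBox 2 M) (etaRaise (fun w : PolySite (halfOpenBox 2 M) => siteStagger (ofLex w.1)) *
          etaLower (fun w : PolySite (halfOpenBox 2 M) => siteStagger (ofLex w.1)))).re / (M : ℝ) ^ 4) =
        fun M : ℕ => (ω.particleHole.expect (halfOpenBox 2 M)
          (etaRaise (fun w : PolySite (halfOpenBox 2 M) => siteStagger (ofLex w.1)) *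
            etaLower (fun w : PolySite (halfOpenBox 2 M) => siteStagger (ofLex w.1)))).re / (M : ℝ) ^ 4 +
          (1 - m) * ((M : ℝ) ^ 2 / (M : ℝ) ^ 4) := by
      funext M
      rw [hkey, card_halfOpenBox]
      push_cast
      ring
    rw [hsplit, show (0 : ℝ) = 0 + (1 - m) * 0 by ring]
    refine hA.1.add (Tendsto.const_mul _ ?_)
    have h2 : (fun M : ℕ => (M : ℝ) ^ 2 / (M : ℝ) ^ 4) =ᶠ[atTop] fun M : ℕ => ((M : ℝ) ^ 2)⁻¹ := by
      filter_upwards [eventually_gt_atTop 0] with M hM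
      have hM' : (0 : ℝ) < M := by exact_mod_cast hM
      field_simp
    rw [tendsto_congr' h2]
    exact tendsto_inv_atTop_zero.comp ((tendsto_pow_atTop two_ne_zero).comp tendsto_natCast_atTop_atTop)
  · rw [hkey]
    have hB := hA.2 hΛ h8
    linarith

/-! ### §2 Electron-doped twins `(U, 2 − n, 0)` of the certified hole-doped cells, from the same claim nodes BY NAME -/
/-- **η-PAIRING ODLRO IS ABSENT at the electron-doped twin A0′ twin `(8, 9/8, 0)`** (nodes #450, #505, #472 BY NAME, through the hole-doped cell
theorem at density `7 / 8` and the §1 mirror): for every translation-invariant ground state of density `9 / 8` at `U = 8`,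
`t' = 0`: `M⁻⁴ Re ω(η†η) → 0` and `Re ω(η†_Λ η_Λ) ≤ 64(|Λ'| − |Λ|)²/(28280138 / 10000000)² + (1 / 8)|Λ|`.
[cite: Yang1989, eqs. (6)–(8)] [cite: BratteliRobinsonII1997, Prop. 5.3.19] [cite: LiebPRL1989, proof of Theorem 2] -/
theorem etaPairing_exclusion_U8_n9o8_tp0
    (h450 : cert_r450_openbox_32x4_U8_N96_tp0_D1400_b2)
    (h505 : cert_r505_HYB_GU8n7o8eom8_w3_b4_R2_ob5p2_kry1_kry2c3rel_menulite_core_focert_it2000)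
    (h472 : cert_r472_pb2_tl_upper_n1_U8)
    {ω : InfVolFermionState 2} (hω : ω.IsTranslationInvariant) (hρ : ω.density = 9 / 8)
    (hme : ω.meanEnergy (hubbardTTPrimeFermionInteraction 1 0 8) 1 = energyDensityTT' 1 0 8 (9 / 8)) :
    Tendsto (fun M : ℕ =>
        (ω.expect (halfOpenBox 2 M) (etaRaise (fun w : PolySite (halfOpenBox 2 M) => siteStagger (ofLex w.1)) *
          etaLower (fun w : PolySite (halfOpenBox 2 M) => siteStagger (ofLex w.1)))).re / (M : ℝ) ^ 4)
        atTop (𝓝 0) ∧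
      ∀ {Λ Λ' : Finset (Site 2)}, Λ ⊆ Λ' → thicken Λ 1 ⊆ Λ' →
        (ω.expect Λ (etaRaise (fun w : PolySite Λ => siteStagger (ofLex w.1)) *
            etaLower (fun w : PolySite Λ => siteStagger (ofLex w.1)))).re ≤
          64 * ((#Λ' : ℝ) - #Λ) ^ 2 / (28280138 / 10000000) ^ 2 + (1 / 8) * #Λ := by
  have h := etaPairing_exclusion_mirror (U := 8) (m := 7 / 8) (c := 28280138 / 10000000) (by norm_num) (by norm_num) (by norm_num)
    (fun hω' hρ' hme' => ⟨tendsto_etaPairing_boxLRO_A0prime h450 h505 h472 hω' hρ' hme',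
      fun hΛ h8 => re_expect_etaRaise_mul_etaLower_le_A0prime h450 h505 h472 hω' hρ' hme' hΛ h8⟩)
    (ω := ω) hω (by rw [hρ]; norm_num) (by rw [hme]; norm_num)
  refine ⟨h.1, fun hΛ h8 => (h.2 hΛ h8).trans (le_of_eq ?_)⟩
  norm_num

/-- **η-PAIRING ODLRO IS ABSENT at the electron-doped twin `(6, 9/8, 0)`** (nodes #426, #473 (u-chord #500), #21 BY NAME, through the hole-doped cell
theorem at density `7 / 8` and the §1 mirror): for every translation-invariant ground state of density `9 / 8` at `U = 6`,
`t' = 0`: `M⁻⁴ Re ω(η†η) → 0` and `Re ω(η†_Λ η_Λ) ≤ 64(|Λ'| − |Λ|)²/(5166236 / 10000000)² + (1 / 8)|Λ|`.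
[cite: Yang1989, eqs. (6)–(8)] [cite: BratteliRobinsonII1997, Prop. 5.3.19] [cite: LiebPRL1989, proof of Theorem 2] -/
theorem etaPairing_exclusion_U6_n9o8_tp0
    (h426 : cert_r426_bs_GU4n7o8tp0_w3_b4_R2_ob5p2_kry1_su2c16_hop2_hanK6B4D4_box5d2_KN4_uprime)
    (h473 : cert_r473_bs_M3U8tp0_w3_b4_R2_ob5p2_kry1_kry2c3rel_hanK7B4D4_KN4_PR20d4_hanK8c2s_hanK8B4D4_uprime)
    (h21 : cert_r21_luc_tl_upper_n1_U6)
    {ω : InfVolFermionState 2} (hω : ω.IsTranslationInvariant) (hρ : ω.density = 9 / 8)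
    (hme : ω.meanEnergy (hubbardTTPrimeFermionInteraction 1 0 6) 1 = energyDensityTT' 1 0 6 (9 / 8)) :
    Tendsto (fun M : ℕ =>
        (ω.expect (halfOpenBox 2 M) (etaRaise (fun w : PolySite (halfOpenBox 2 M) => siteStagger (ofLex w.1)) *
          etaLower (fun w : PolySite (halfOpenBox 2 M) => siteStagger (ofLex w.1)))).re / (M : ℝ) ^ 4)
        atTop (𝓝 0) ∧
      ∀ {Λ Λ' : Finset (Site 2)}, Λ ⊆ Λ' → thicken Λ 1 ⊆ Λ' →
        (ω.expect Λ (etaRaise (fun w : PolySite Λ => siteStagger (ofLex w.1)) *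
            etaLower (fun w : PolySite Λ => siteStagger (ofLex w.1)))).re ≤
          64 * ((#Λ' : ℝ) - #Λ) ^ 2 / (5166236 / 10000000) ^ 2 + (1 / 8) * #Λ := by
  have h := etaPairing_exclusion_mirror (U := 6) (m := 7 / 8) (c := 5166236 / 10000000) (by norm_num) (by norm_num) (by norm_num)
    (fun hω' hρ' hme' => etaPairing_exclusion_U6_n7o8_tp0 h426 h473 h21 hω' hρ' hme')
    (ω := ω) hω (by rw [hρ]; norm_num) (by rw [hme]; norm_num)
  refine ⟨h.1, fun hΛ h8 => (h.2 hΛ h8).trans (le_of_eq ?_)⟩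
  norm_num

/-- **η-PAIRING ODLRO IS ABSENT at the electron-doped twin `(8, 5/4, 0)`** (nodes #516, #472 BY NAME, through the hole-doped cell
theorem at density `3 / 4` and the §1 mirror): for every translation-invariant ground state of density `5 / 4` at `U = 8`,
`t' = 0`: `M⁻⁴ Re ω(η†η) → 0` and `Re ω(η†_Λ η_Λ) ≤ 64(|Λ'| − |Λ|)²/(3972746 / 1000000)² + (1 / 4)|Λ|`.
[cite: Yang1989, eqs. (6)–(8)] [cite: BratteliRobinsonII1997, Prop. 5.3.19] [cite: LiebPRL1989, proof of Theorem 2] -/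
theorem etaPairing_exclusion_U8_n5o4_tp0
    (h516 : cert_r516_HYB_GU8n3o4eom8_w3_b4_R2_ob5p2_kry1_kry2c3rel_menulite_core_twin_focert_it6000)
    (h472 : cert_r472_pb2_tl_upper_n1_U8)
    {ω : InfVolFermionState 2} (hω : ω.IsTranslationInvariant) (hρ : ω.density = 5 / 4)
    (hme : ω.meanEnergy (hubbardTTPrimeFermionInteraction 1 0 8) 1 = energyDensityTT' 1 0 8 (5 / 4)) :
    Tendsto (fun M : ℕ =>
        (ω.expect (halfOpenBox 2 M) (etaRaise (fun w : PolySite (halfOpenBox 2 M) => siteStagger (ofLex w.1)) *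
          etaLower (fun w : PolySite (halfOpenBox 2 M) => siteStagger (ofLex w.1)))).re / (M : ℝ) ^ 4)
        atTop (𝓝 0) ∧
      ∀ {Λ Λ' : Finset (Site 2)}, Λ ⊆ Λ' → thicken Λ 1 ⊆ Λ' →
        (ω.expect Λ (etaRaise (fun w : PolySite Λ => siteStagger (ofLex w.1)) *
            etaLower (fun w : PolySite Λ => siteStagger (ofLex w.1)))).re ≤
          64 * ((#Λ' : ℝ) - #Λ) ^ 2 / (3972746 / 1000000) ^ 2 + (1 / 4) * #Λ := by
  have h := etaPairing_exclusion_mirror (U := 8) (m := 3 / 4) (c := 3972746 / 1000000) (by norm_num) (by norm_num) (by norm_num)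
    (fun hω' hρ' hme' => etaPairing_exclusion_U8_n3o4_tp0 h516 h472 hω' hρ' hme')
    (ω := ω) hω (by rw [hρ]; norm_num) (by rw [hme]; norm_num)
  refine ⟨h.1, fun hΛ h8 => (h.2 hΛ h8).trans (le_of_eq ?_)⟩
  norm_num

/-- **η-PAIRING ODLRO IS ABSENT at the electron-doped twin `(8, 6/5, 0)`** (nodes #515, #472 BY NAME, through the hole-doped cell
theorem at density `4 / 5` and the §1 mirror): for every translation-invariant ground state of density `6 / 5` at `U = 8`,
`t' = 0`: `M⁻⁴ Re ω(η†η) → 0` and `Re ω(η†_Λ η_Λ) ≤ 64(|Λ'| − |Λ|)²/(35850226 / 10000000)² + (1 / 5)|Λ|`.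
[cite: Yang1989, eqs. (6)–(8)] [cite: BratteliRobinsonII1997, Prop. 5.3.19] [cite: LiebPRL1989, proof of Theorem 2] -/
theorem etaPairing_exclusion_U8_n6o5_tp0
    (h515 : cert_r515_HYB_GU8n4o5eom8_w3_b4_R2_ob5p2_kry1_kry2c3rel_menulite_core_twin_focert_it6000)
    (h472 : cert_r472_pb2_tl_upper_n1_U8)
    {ω : InfVolFermionState 2} (hω : ω.IsTranslationInvariant) (hρ : ω.density = 6 / 5)
    (hme : ω.meanEnergy (hubbardTTPrimeFermionInteraction 1 0 8) 1 = energyDensityTT' 1 0 8 (6 / 5)) :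
    Tendsto (fun M : ℕ =>
        (ω.expect (halfOpenBox 2 M) (etaRaise (fun w : PolySite (halfOpenBox 2 M) => siteStagger (ofLex w.1)) *
          etaLower (fun w : PolySite (halfOpenBox 2 M) => siteStagger (ofLex w.1)))).re / (M : ℝ) ^ 4)
        atTop (𝓝 0) ∧
      ∀ {Λ Λ' : Finset (Site 2)}, Λ ⊆ Λ' → thicken Λ 1 ⊆ Λ' →
        (ω.expect Λ (etaRaise (fun w : PolySite Λ => siteStagger (ofLex w.1)) *
            etaLower (fun w : PolySite Λ => siteStagger (ofLex w.1)))).re ≤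
          64 * ((#Λ' : ℝ) - #Λ) ^ 2 / (35850226 / 10000000) ^ 2 + (1 / 5) * #Λ := by
  have h := etaPairing_exclusion_mirror (U := 8) (m := 4 / 5) (c := 35850226 / 10000000) (by norm_num) (by norm_num) (by norm_num)
    (fun hω' hρ' hme' => etaPairing_exclusion_U8_n4o5_tp0 h515 h472 hω' hρ' hme')
    (ω := ω) hω (by rw [hρ]; norm_num) (by rw [hme]; norm_num)
  refine ⟨h.1, fun hΛ h8 => (h.2 hΛ h8).trans (le_of_eq ?_)⟩
  norm_num

/-- **η-PAIRING ODLRO IS ABSENT at the electron-doped twin `(4, 5/4, 0)`** (nodes #518, #20 BY NAME, through the hole-doped cell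
theorem at density `3 / 4` and the §1 mirror): for every translation-invariant ground state of density `5 / 4` at `U = 4`,
`t' = 0`: `M⁻⁴ Re ω(η†η) → 0` and `Re ω(η†_Λ η_Λ) ≤ 64(|Λ'| − |Λ|)²/(7175002 / 10000000)² + (1 / 4)|Λ|`.
[cite: Yang1989, eqs. (6)–(8)] [cite: BratteliRobinsonII1997, Prop. 5.3.19] [cite: LiebPRL1989, proof of Theorem 2] -/
theorem etaPairing_exclusion_U4_n5o4_tp0
    (h518 : DerivedNTangent34R426.derived_r426_ntangent_sq_U4_n3o4_tp0)
    (h20 : cert_r20_luc_tl_upper_n1_U4)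
    {ω : InfVolFermionState 2} (hω : ω.IsTranslationInvariant) (hρ : ω.density = 5 / 4)
    (hme : ω.meanEnergy (hubbardTTPrimeFermionInteraction 1 0 4) 1 = energyDensityTT' 1 0 4 (5 / 4)) :
    Tendsto (fun M : ℕ =>
        (ω.expect (halfOpenBox 2 M) (etaRaise (fun w : PolySite (halfOpenBox 2 M) => siteStagger (ofLex w.1)) *
          etaLower (fun w : PolySite (halfOpenBox 2 M) => siteStagger (ofLex w.1)))).re / (M : ℝ) ^ 4)
        atTop (𝓝 0) ∧
      ∀ {Λ Λ' : Finset (Site 2)}, Λ ⊆ Λ' → thicken Λ 1 ⊆ Λ' →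
        (ω.expect Λ (etaRaise (fun w : PolySite Λ => siteStagger (ofLex w.1)) *
            etaLower (fun w : PolySite Λ => siteStagger (ofLex w.1)))).re ≤
          64 * ((#Λ' : ℝ) - #Λ) ^ 2 / (7175002 / 10000000) ^ 2 + (1 / 4) * #Λ := by
  have h := etaPairing_exclusion_mirror (U := 4) (m := 3 / 4) (c := 7175002 / 10000000) (by norm_num) (by norm_num) (by norm_num)
    (fun hω' hρ' hme' => etaPairing_exclusion_U4_n3o4_tp0 h518 h20 hω' hρ' hme')
    (ω := ω) hω (by rw [hρ]; norm_num) (by rw [hme]; norm_num)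
  refine ⟨h.1, fun hΛ h8 => (h.2 hΛ h8).trans (le_of_eq ?_)⟩
  norm_num

/-- **η-PAIRING ODLRO IS ABSENT at the electron-doped twin `(4, 6/5, 0)`** (nodes #512, #20 BY NAME, through the hole-doped cell
theorem at density `4 / 5` and the §1 mirror): for every translation-invariant ground state of density `6 / 5` at `U = 4`,
`t' = 0`: `M⁻⁴ Re ω(η†η) → 0` and `Re ω(η†_Λ η_Λ) ≤ 64(|Λ'| − |Λ|)²/(4583430 / 10000000)² + (1 / 5)|Λ|`.
[cite: Yang1989, eqs. (6)–(8)] [cite: BratteliRobinsonII1997, Prop. 5.3.19] [cite: LiebPRL1989, proof of Theorem 2] -/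
theorem etaPairing_exclusion_U4_n6o5_tp0
    (h512 : DerivedNTangent45R426.derived_r426_ntangent_sq_U4_n4o5_tp0)
    (h20 : cert_r20_luc_tl_upper_n1_U4)
    {ω : InfVolFermionState 2} (hω : ω.IsTranslationInvariant) (hρ : ω.density = 6 / 5)
    (hme : ω.meanEnergy (hubbardTTPrimeFermionInteraction 1 0 4) 1 = energyDensityTT' 1 0 4 (6 / 5)) :
    Tendsto (fun M : ℕ =>
        (ω.expect (halfOpenBox 2 M) (etaRaise (fun w : PolySite (halfOpenBox 2 M) => siteStagger (ofLex w.1)) *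
          etaLower (fun w : PolySite (halfOpenBox 2 M) => siteStagger (ofLex w.1)))).re / (M : ℝ) ^ 4)
        atTop (𝓝 0) ∧
      ∀ {Λ Λ' : Finset (Site 2)}, Λ ⊆ Λ' → thicken Λ 1 ⊆ Λ' →
        (ω.expect Λ (etaRaise (fun w : PolySite Λ => siteStagger (ofLex w.1)) *
            etaLower (fun w : PolySite Λ => siteStagger (ofLex w.1)))).re ≤
          64 * ((#Λ' : ℝ) - #Λ) ^ 2 / (4583430 / 10000000) ^ 2 + (1 / 5) * #Λ := by
  have h := etaPairing_exclusion_mirror (U := 4) (m := 4 / 5) (c := 4583430 / 10000000) (by norm_num) (by norm_num) (by norm_num)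
    (fun hω' hρ' hme' => etaPairing_exclusion_U4_n4o5_tp0 h512 h20 hω' hρ' hme')
    (ω := ω) hω (by rw [hρ]; norm_num) (by rw [hme]; norm_num)
  refine ⟨h.1, fun hΛ h8 => (h.2 hΛ h8).trans (le_of_eq ?_)⟩
  norm_num

/-- **η-PAIRING ODLRO IS ABSENT at the electron-doped twin `(6, 5/4, 0)`** (nodes #518, #516 (u-chord #522), #21 BY NAME, through the hole-doped cell
theorem at density `3 / 4` and the §1 mirror): for every translation-invariant ground state of density `5 / 4` at `U = 6`,
`t' = 0`: `M⁻⁴ Re ω(η†η) → 0` and `Re ω(η†_Λ η_Λ) ≤ 64(|Λ'| − |Λ|)²/(19970566 / 10000000)² + (1 / 4)|Λ|`.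
[cite: Yang1989, eqs. (6)–(8)] [cite: BratteliRobinsonII1997, Prop. 5.3.19] [cite: LiebPRL1989, proof of Theorem 2] -/
theorem etaPairing_exclusion_U6_n5o4_tp0
    (h518 : DerivedNTangent34R426.derived_r426_ntangent_sq_U4_n3o4_tp0)
    (h516 : cert_r516_HYB_GU8n3o4eom8_w3_b4_R2_ob5p2_kry1_kry2c3rel_menulite_core_twin_focert_it6000)
    (h21 : cert_r21_luc_tl_upper_n1_U6)
    {ω : InfVolFermionState 2} (hω : ω.IsTranslationInvariant) (hρ : ω.density = 5 / 4)
    (hme : ω.meanEnergy (hubbardTTPrimeFermionInteraction 1 0 6) 1 = energyDensityTT' 1 0 6 (5 / 4)) :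
    Tendsto (fun M : ℕ =>
        (ω.expect (halfOpenBox 2 M) (etaRaise (fun w : PolySite (halfOpenBox 2 M) => siteStagger (ofLex w.1)) *
          etaLower (fun w : PolySite (halfOpenBox 2 M) => siteStagger (ofLex w.1)))).re / (M : ℝ) ^ 4)
        atTop (𝓝 0) ∧
      ∀ {Λ Λ' : Finset (Site 2)}, Λ ⊆ Λ' → thicken Λ 1 ⊆ Λ' →
        (ω.expect Λ (etaRaise (fun w : PolySite Λ => siteStagger (ofLex w.1)) *
            etaLower (fun w : PolySite Λ => siteStagger (ofLex w.1)))).re ≤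
          64 * ((#Λ' : ℝ) - #Λ) ^ 2 / (19970566 / 10000000) ^ 2 + (1 / 4) * #Λ := by
  have h := etaPairing_exclusion_mirror (U := 6) (m := 3 / 4) (c := 19970566 / 10000000) (by norm_num) (by norm_num) (by norm_num)
    (fun hω' hρ' hme' => etaPairing_exclusion_U6_n3o4_tp0 h518 h516 h21 hω' hρ' hme')
    (ω := ω) hω (by rw [hρ]; norm_num) (by rw [hme]; norm_num)
  refine ⟨h.1, fun hΛ h8 => (h.2 hΛ h8).trans (le_of_eq ?_)⟩
  norm_num

/-- **η-PAIRING ODLRO IS ABSENT at the electron-doped twin `(6, 6/5, 0)`** (nodes #512, #515 (u-chord #520), #21 BY NAME, through the hole-doped cell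
theorem at density `4 / 5` and the §1 mirror): for every translation-invariant ground state of density `6 / 5` at `U = 6`,
`t' = 0`: `M⁻⁴ Re ω(η†η) → 0` and `Re ω(η†_Λ η_Λ) ≤ 64(|Λ'| − |Λ|)²/(15865996 / 10000000)² + (1 / 5)|Λ|`.
[cite: Yang1989, eqs. (6)–(8)] [cite: BratteliRobinsonII1997, Prop. 5.3.19] [cite: LiebPRL1989, proof of Theorem 2] -/
theorem etaPairing_exclusion_U6_n6o5_tp0
    (h512 : DerivedNTangent45R426.derived_r426_ntangent_sq_U4_n4o5_tp0)
    (h515 : cert_r515_HYB_GU8n4o5eom8_w3_b4_R2_ob5p2_kry1_kry2c3rel_menulite_core_twin_focert_it6000)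
    (h21 : cert_r21_luc_tl_upper_n1_U6)
    {ω : InfVolFermionState 2} (hω : ω.IsTranslationInvariant) (hρ : ω.density = 6 / 5)
    (hme : ω.meanEnergy (hubbardTTPrimeFermionInteraction 1 0 6) 1 = energyDensityTT' 1 0 6 (6 / 5)) :
    Tendsto (fun M : ℕ =>
        (ω.expect (halfOpenBox 2 M) (etaRaise (fun w : PolySite (halfOpenBox 2 M) => siteStagger (ofLex w.1)) *
          etaLower (fun w : PolySite (halfOpenBox 2 M) => siteStagger (ofLex w.1)))).re / (M : ℝ) ^ 4)
        atTop (𝓝 0) ∧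
      ∀ {Λ Λ' : Finset (Site 2)}, Λ ⊆ Λ' → thicken Λ 1 ⊆ Λ' →
        (ω.expect Λ (etaRaise (fun w : PolySite Λ => siteStagger (ofLex w.1)) *
            etaLower (fun w : PolySite Λ => siteStagger (ofLex w.1)))).re ≤
          64 * ((#Λ' : ℝ) - #Λ) ^ 2 / (15865996 / 10000000) ^ 2 + (1 / 5) * #Λ := by
  have h := etaPairing_exclusion_mirror (U := 6) (m := 4 / 5) (c := 15865996 / 10000000) (by norm_num) (by norm_num) (by norm_num)
    (fun hω' hρ' hme' => etaPairing_exclusion_U6_n4o5_tp0 h512 h515 h21 hω' hρ' hme')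
    (ω := ω) hω (by rw [hρ]; norm_num) (by rw [hme]; norm_num)
  refine ⟨h.1, fun hΛ h8 => (h.2 hΛ h8).trans (le_of_eq ?_)⟩
  norm_num

/-- **η-PAIRING ODLRO IS ABSENT at the electron-doped twin `(2, 6/5, 0)`** (nodes #527, #27 BY NAME, through the hole-doped cell
theorem at density `4 / 5` and the §1 mirror): for every translation-invariant ground state of density `6 / 5` at `U = 2`,
`t' = 0`: `M⁻⁴ Re ω(η†η) → 0` and `Re ω(η†_Λ η_Λ) ≤ 64(|Λ'| − |Λ|)²/(677408 / 10000000)² + (1 / 5)|Λ|`.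
[cite: Yang1989, eqs. (6)–(8)] [cite: BratteliRobinsonII1997, Prop. 5.3.19] [cite: LiebPRL1989, proof of Theorem 2] -/
theorem etaPairing_exclusion_U2_n6o5_tp0
    (h527 : DerivedNTangent45R507.derived_r507_ntangent_sq_U2_n4o5_tp0)
    (h27 : cert_r27_luc_tl_upper_n1_U2)
    {ω : InfVolFermionState 2} (hω : ω.IsTranslationInvariant) (hρ : ω.density = 6 / 5)
    (hme : ω.meanEnergy (hubbardTTPrimeFermionInteraction 1 0 2) 1 = energyDensityTT' 1 0 2 (6 / 5)) :
    Tendsto (fun M : ℕ =>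
        (ω.expect (halfOpenBox 2 M) (etaRaise (fun w : PolySite (halfOpenBox 2 M) => siteStagger (ofLex w.1)) *
          etaLower (fun w : PolySite (halfOpenBox 2 M) => siteStagger (ofLex w.1)))).re / (M : ℝ) ^ 4)
        atTop (𝓝 0) ∧
      ∀ {Λ Λ' : Finset (Site 2)}, Λ ⊆ Λ' → thicken Λ 1 ⊆ Λ' →
        (ω.expect Λ (etaRaise (fun w : PolySite Λ => siteStagger (ofLex w.1)) *
            etaLower (fun w : PolySite Λ => siteStagger (ofLex w.1)))).re ≤
          64 * ((#Λ' : ℝ) - #Λ) ^ 2 / (677408 / 10000000) ^ 2 + (1 / 5) * #Λ := by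
  have h := etaPairing_exclusion_mirror (U := 2) (m := 4 / 5) (c := 677408 / 10000000) (by norm_num) (by norm_num) (by norm_num)
    (fun hω' hρ' hme' => etaPairing_exclusion_U2_n4o5_tp0 h527 h27 hω' hρ' hme')
    (ω := ω) hω (by rw [hρ]; norm_num) (by rw [hme]; norm_num)
  refine ⟨h.1, fun hΛ h8 => (h.2 hΛ h8).trans (le_of_eq ?_)⟩
  norm_num

/-- **η-PAIRING ODLRO IS ABSENT at the electron-doped twin `(5, 5/4, 0)`** (nodes #518, #516 (in-file u-chord), #396 BY NAME, through the hole-doped cell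
theorem at density `3 / 4` and the §1 mirror): for every translation-invariant ground state of density `5 / 4` at `U = 5`,
`t' = 0`: `M⁻⁴ Re ω(η†η) → 0` and `Re ω(η†_Λ η_Λ) ≤ 64(|Λ'| − |Λ|)²/(3152833 / 2500000)² + (1 / 4)|Λ|`.
[cite: Yang1989, eqs. (6)–(8)] [cite: BratteliRobinsonII1997, Prop. 5.3.19] [cite: LiebPRL1989, proof of Theorem 2] -/
theorem etaPairing_exclusion_U5_n5o4_tp0
    (h518 : DerivedNTangent34R426.derived_r426_ntangent_sq_U4_n3o4_tp0)
    (h516 : cert_r516_HYB_GU8n3o4eom8_w3_b4_R2_ob5p2_kry1_kry2c3rel_menulite_core_twin_focert_it6000)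
    (h396 : cert_r396_luc_tl_upper_n1_U5)
    {ω : InfVolFermionState 2} (hω : ω.IsTranslationInvariant) (hρ : ω.density = 5 / 4)
    (hme : ω.meanEnergy (hubbardTTPrimeFermionInteraction 1 0 5) 1 = energyDensityTT' 1 0 5 (5 / 4)) :
    Tendsto (fun M : ℕ =>
        (ω.expect (halfOpenBox 2 M) (etaRaise (fun w : PolySite (halfOpenBox 2 M) => siteStagger (ofLex w.1)) *
          etaLower (fun w : PolySite (halfOpenBox 2 M) => siteStagger (ofLex w.1)))).re / (M : ℝ) ^ 4)
        atTop (𝓝 0) ∧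
      ∀ {Λ Λ' : Finset (Site 2)}, Λ ⊆ Λ' → thicken Λ 1 ⊆ Λ' →
        (ω.expect Λ (etaRaise (fun w : PolySite Λ => siteStagger (ofLex w.1)) *
            etaLower (fun w : PolySite Λ => siteStagger (ofLex w.1)))).re ≤
          64 * ((#Λ' : ℝ) - #Λ) ^ 2 / (3152833 / 2500000) ^ 2 + (1 / 4) * #Λ := by
  have h := etaPairing_exclusion_mirror (U := 5) (m := 3 / 4) (c := 3152833 / 2500000) (by norm_num) (by norm_num) (by norm_num)
    (fun hω' hρ' hme' => etaPairing_exclusion_U5_n3o4_tp0 h518 h516 h396 hω' hρ' hme')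
    (ω := ω) hω (by rw [hρ]; norm_num) (by rw [hme]; norm_num)
  refine ⟨h.1, fun hΛ h8 => (h.2 hΛ h8).trans (le_of_eq ?_)⟩
  norm_num

/-- **η-PAIRING ODLRO IS ABSENT at the electron-doped twin `(5, 6/5, 0)`** (nodes #512, #515 (in-file u-chord), #396 BY NAME, through the hole-doped cell
theorem at density `4 / 5` and the §1 mirror): for every translation-invariant ground state of density `6 / 5` at `U = 5`,
`t' = 0`: `M⁻⁴ Re ω(η†η) → 0` and `Re ω(η†_Λ η_Λ) ≤ 64(|Λ'| − |Λ|)²/(4511449 / 5000000)² + (1 / 5)|Λ|`.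
[cite: Yang1989, eqs. (6)–(8)] [cite: BratteliRobinsonII1997, Prop. 5.3.19] [cite: LiebPRL1989, proof of Theorem 2] -/
theorem etaPairing_exclusion_U5_n6o5_tp0
    (h512 : DerivedNTangent45R426.derived_r426_ntangent_sq_U4_n4o5_tp0)
    (h515 : cert_r515_HYB_GU8n4o5eom8_w3_b4_R2_ob5p2_kry1_kry2c3rel_menulite_core_twin_focert_it6000)
    (h396 : cert_r396_luc_tl_upper_n1_U5)
    {ω : InfVolFermionState 2} (hω : ω.IsTranslationInvariant) (hρ : ω.density = 6 / 5)
    (hme : ω.meanEnergy (hubbardTTPrimeFermionInteraction 1 0 5) 1 = energyDensityTT' 1 0 5 (6 / 5)) :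
    Tendsto (fun M : ℕ =>
        (ω.expect (halfOpenBox 2 M) (etaRaise (fun w : PolySite (halfOpenBox 2 M) => siteStagger (ofLex w.1)) *
          etaLower (fun w : PolySite (halfOpenBox 2 M) => siteStagger (ofLex w.1)))).re / (M : ℝ) ^ 4)
        atTop (𝓝 0) ∧
      ∀ {Λ Λ' : Finset (Site 2)}, Λ ⊆ Λ' → thicken Λ 1 ⊆ Λ' →
        (ω.expect Λ (etaRaise (fun w : PolySite Λ => siteStagger (ofLex w.1)) *
            etaLower (fun w : PolySite Λ => siteStagger (ofLex w.1)))).re ≤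
          64 * ((#Λ' : ℝ) - #Λ) ^ 2 / (4511449 / 5000000) ^ 2 + (1 / 5) * #Λ := by
  have h := etaPairing_exclusion_mirror (U := 5) (m := 4 / 5) (c := 4511449 / 5000000) (by norm_num) (by norm_num) (by norm_num)
    (fun hω' hρ' hme' => etaPairing_exclusion_U5_n4o5_tp0 h512 h515 h396 hω' hρ' hme')
    (ω := ω) hω (by rw [hρ]; norm_num) (by rw [hme]; norm_num)
  refine ⟨h.1, fun hΛ h8 => (h.2 hΛ h8).trans (le_of_eq ?_)⟩
  norm_num

/-- **η-PAIRING ODLRO IS ABSENT at the electron-doped twin `(3, 6/5, 0)`** (nodes #527, #512 (in-file u-chord), #395 BY NAME, through the hole-doped cell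
theorem at density `4 / 5` and the §1 mirror): for every translation-invariant ground state of density `6 / 5` at `U = 3`,
`t' = 0`: `M⁻⁴ Re ω(η†η) → 0` and `Re ω(η†_Λ η_Λ) ≤ 64(|Λ'| − |Λ|)²/(405897 / 5000000)² + (1 / 5)|Λ|`.
[cite: Yang1989, eqs. (6)–(8)] [cite: BratteliRobinsonII1997, Prop. 5.3.19] [cite: LiebPRL1989, proof of Theorem 2] -/
theorem etaPairing_exclusion_U3_n6o5_tp0
    (h527 : DerivedNTangent45R507.derived_r507_ntangent_sq_U2_n4o5_tp0)
    (h512 : DerivedNTangent45R426.derived_r426_ntangent_sq_U4_n4o5_tp0)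
    (h395 : cert_r395_luc_tl_upper_n1_U3)
    {ω : InfVolFermionState 2} (hω : ω.IsTranslationInvariant) (hρ : ω.density = 6 / 5)
    (hme : ω.meanEnergy (hubbardTTPrimeFermionInteraction 1 0 3) 1 = energyDensityTT' 1 0 3 (6 / 5)) :
    Tendsto (fun M : ℕ =>
        (ω.expect (halfOpenBox 2 M) (etaRaise (fun w : PolySite (halfOpenBox 2 M) => siteStagger (ofLex w.1)) *
          etaLower (fun w : PolySite (halfOpenBox 2 M) => siteStagger (ofLex w.1)))).re / (M : ℝ) ^ 4)
        atTop (𝓝 0) ∧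
      ∀ {Λ Λ' : Finset (Site 2)}, Λ ⊆ Λ' → thicken Λ 1 ⊆ Λ' →
        (ω.expect Λ (etaRaise (fun w : PolySite Λ => siteStagger (ofLex w.1)) *
            etaLower (fun w : PolySite Λ => siteStagger (ofLex w.1)))).re ≤
          64 * ((#Λ' : ℝ) - #Λ) ^ 2 / (405897 / 5000000) ^ 2 + (1 / 5) * #Λ := by
  have h := etaPairing_exclusion_mirror (U := 3) (m := 4 / 5) (c := 405897 / 5000000) (by norm_num) (by norm_num) (by norm_num)
    (fun hω' hρ' hme' => etaPairing_exclusion_U3_n4o5_tp0 h527 h512 h395 hω' hρ' hme')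
    (ω := ω) hω (by rw [hρ]; norm_num) (by rw [hme]; norm_num)
  refine ⟨h.1, fun hΛ h8 => (h.2 hΛ h8).trans (le_of_eq ?_)⟩
  norm_num

end Summit.Ventures.CertifiedManyBodySolver.Observables

end
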